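import Literature.InformationTheory.QuantumCodes.OptimalRadius
import Literature.InformationTheory.QuantumCodes.CSSEquivalence
import Literature.InformationTheory.QuantumCodes.RotatedSurfaceCodeDistance
import Literature.InformationTheory.QuantumCodes.TwistedToricExamples
import Literature.InformationTheory.QuantumCodes.TwistedToricRotatedFamily
import HarnessLib

/-!
# The packaged Q4 radius `CSSCode.HasOptimalRadius` for code families on arbitrary finite qubit types (flattening along
# `Fintype.equivFin`), with the rotated-surface and toric / twisted-toric families as instances

Topic `InformationTheory/QuantumCodes`; namespace `Literature.InformationTheory.QuantumCodes`. LADDER-QEC (cell `qec`),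
PARTITION row 08 (Q4 theorem column for FAMILIES). The census's radius predicate `CSSCode.HasOptimalRadius C t`
(`OptimalRadius.lean`: SOME Pauli decoder of `C` has symplectic-weight correction radius EXACTLY `t`, and NO Pauli decoder,
sector-wise or not, corrects every error of weight `≤ t + 1`) is stated for codes on the qubit type `Fin n` (it lives in the
symplectic picture `SympVec n`). Family theorems in the tree live on structured qubit types (`Fin L × Fin L` for the
rotated surface code, `G ⊕ G` for the twisted tori, …). This file closes that gap ONCE:

* `CSSCode.flatFin C := C.reindex id id (Fintype.equivFin Q)` — the same code with qubits renumbered `0 … |Q|−1`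
  (FACT P: all parameters unchanged, `CSSCode.reindex_isCode_iff`); `IsCode.flatFin`, and
  ★ `IsCode.flatFin_hasOptimalRadius (h : C.IsCode m k d) (ht : (d−1)/2 = t) : C.flatFin.HasOptimalRadius t`, plus the
  version along any chosen numbering `IsCode.hasOptimalRadius_reindex … (e : Q ≃ Fin n)`.
* Instances (one line each from the family theorems in the tree): rotated surface code `⟦L², 1, L⟧`
  (`RotatedSurface.flatFin_hasOptimalRadius : … ((L−1)/2)`), square toric `⟦2L², 2, L⟧`, rectangular toric
  `⟦2L₁L₂, 2, min(L₁,L₂)⟧`, every twisted torus `⟦2|G|, 2, sys₁⟧` (`TwistedToric.flatFin_hasOptimalRadius`), the cyclic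
  rotated family `⟦2c, 2, 2t+1⟧` (radius exactly `t`) and KP13 Example 7 `⟦2n²c, 2, n(2t+1)⟧`.

0 named facts, no `decide`, no instances/notation; axioms standard. HONEST FRAMING: bookkeeping corollaries (generic min-weight
decoder + optimality over all decoders, transported along a qubit renumbering); no new parameter, no novelty.

References: [Gottesman1997, §2.3 (chunk p0014 L3: distance 2t+1 corrects t)]; [LinPryadko2024, §4.2 Thm 6 (arXiv:2306.16400
p0009 L66–74: permutation equivalence preserves parameters)]; family locators as in the imported files ([DennisEtAl2002],
[KovalevPryadko2012], [KovalevPryadko2013Hyperbicycle], [BombinMartinDelgado2007Optimal], [TomitaSvore2014]).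
-/

namespace Literature.InformationTheory.QuantumCodes

namespace CSSCode

variable {RX RZ Q : Type*} [Fintype RX] [Fintype RZ] [Fintype Q] [DecidableEq Q]

/-- **Radius along any qubit numbering**: an `[[n,k,d]]` code renumbered by `e : Q ≃ Fin n` has optimal Pauli-level
correction radius `t = ⌊(d−1)/2⌋`. [cite: Gottesman1997, §2.3 (chunk p0014 L3)] [cite: LinPryadko2024, §4.2 Thm 6 (arXiv:2306.16400 p0009 L66-74)] -/
theorem IsCode.hasOptimalRadius_reindex {n : ℕ} {C : CSSCode RX RZ Q} {m k d t : ℕ} (h : C.IsCode m k d)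
    (e : Q ≃ Fin n) (ht : (d - 1) / 2 = t) : (C.reindex (Equiv.refl RX) (Equiv.refl RZ) e).HasOptimalRadius t :=
  ((C.reindex_isCode_iff (Equiv.refl RX) (Equiv.refl RZ) e m k d).2 h).hasOptimalRadius_of_eq ht

/-- The **canonical flattening** of a CSS code: qubits renumbered `0 … |Q| − 1` along `Fintype.equivFin` (check index types
unchanged). (definition) [cite: LinPryadko2024, §4.2 Thm 6 (arXiv:2306.16400 p0009 L66-74)] -/
noncomputable def flatFin (C : CSSCode RX RZ Q) : CSSCode RX RZ (Fin (Fintype.card Q)) :=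
  C.reindex (Equiv.refl RX) (Equiv.refl RZ) (Fintype.equivFin Q)

/-- Flattening preserves `[[n,k,d]]` (FACT P). [cite: LinPryadko2024, §4.2 Thm 6 (arXiv:2306.16400 p0009 L66-74)] -/
theorem IsCode.flatFin {C : CSSCode RX RZ Q} {m k d : ℕ} (h : C.IsCode m k d) : C.flatFin.IsCode m k d :=
  (C.reindex_isCode_iff _ _ _ m k d).2 h

/-- ★ **The Q4 radius column for a family on ANY finite qubit type**: an `[[n,k,d]]` code, flattened, has optimal
Pauli-level correction radius `⌊(d−1)/2⌋` (attained by sector-wise minimum-weight decoding; unbeatable by any Pauli decoder).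
[cite: Gottesman1997, §2.3 (chunk p0014 L3)] -/
theorem IsCode.flatFin_hasOptimalRadius {C : CSSCode RX RZ Q} {m k d t : ℕ} (h : C.IsCode m k d)
    (ht : (d - 1) / 2 = t) : C.flatFin.HasOptimalRadius t :=
  h.flatFin.hasOptimalRadius_of_eq ht

end CSSCode

/-! ## Instances: the family theorems of the tree -/

namespace RotatedSurface

/-- **Rotated surface code `RSC(L) = ⟦L², 1, L⟧`, every `L ≥ 1`: optimal Pauli-level radius `⌊(L−1)/2⌋`, attained.**
[cite: BombinMartinDelgado2007Optimal, §IV (p0007 L1-9)] [cite: Gottesman1997, §2.3 (chunk p0014 L3)] -/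
theorem flatFin_hasOptimalRadius {L : ℕ} (hL : 0 < L) : (code L).flatFin.HasOptimalRadius ((L - 1) / 2) :=
  (code_isCode hL).flatFin_hasOptimalRadius rfl

end RotatedSurface

namespace TwistedToric

/-- **Every twisted toric code `LP[1 + x^{g₁}, 1 + x^{g₂}] = ⟦2|G|, 2, sys₁⟧`: optimal Pauli-level radius `⌊(sys₁ − 1)/2⌋`,
attained.** [cite: KovalevPryadko2012, §III.C (p0005 L52-80)] [cite: Gottesman1997, §2.3 (chunk p0014 L3)] -/
theorem flatFin_hasOptimalRadius {G : Type*} [AddCommGroup G] [DecidableEq G] [Fintype G] {g₁ g₂ : G}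
    (hgen : AddSubgroup.closure ({g₁, g₂} : Set G) = ⊤) :
    (code g₁ g₂).flatFin.HasOptimalRadius ((systole g₁ g₂ - 1) / 2) :=
  (code_isCode hgen).flatFin_hasOptimalRadius rfl

/-- **Square toric code `⟦2L², 2, L⟧`, every `L ≥ 1`: optimal Pauli-level radius `⌊(L−1)/2⌋`, attained.**
[cite: DennisEtAl2002, §3.1 (chunk p0008 L5: «the code distance is d=L»)] [cite: Gottesman1997, §2.3 (chunk p0014 L3)] -/
theorem toric_flatFin_hasOptimalRadius (L : ℕ) [NeZero L] :
    (code ((1, 0) : ZMod L × ZMod L) (0, 1)).flatFin.HasOptimalRadius ((L - 1) / 2) :=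
  (toric_isCode L).flatFin_hasOptimalRadius rfl

/-- **Rectangular toric code `⟦2L₁L₂, 2, min(L₁,L₂)⟧`: optimal Pauli-level radius `⌊(min(L₁,L₂)−1)/2⌋`, attained.**
[cite: KovalevPryadko2012, §III.C Ex. 2 (p0005 L86-92)] [cite: Gottesman1997, §2.3 (chunk p0014 L3)] -/
theorem toricRect_flatFin_hasOptimalRadius (L₁ L₂ : ℕ) [NeZero L₁] [NeZero L₂] :
    (code ((1, 0) : ZMod L₁ × ZMod L₂) (0, 1)).flatFin.HasOptimalRadius ((min L₁ L₂ - 1) / 2) :=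
  (toricRect_isCode L₁ L₂).flatFin_hasOptimalRadius rfl

/-- **The cyclic rotated family `⟦2c, 2, 2t+1⟧` (`c = t² + (t+1)²`): optimal Pauli-level radius EXACTLY `t`, attained.**
[cite: KovalevPryadko2013Hyperbicycle, §III.B Ex. 2 (p0008 L11-15)] [cite: Gottesman1997, §2.3 (chunk p0014 L3)] -/
theorem rotated_flatFin_hasOptimalRadius {c : ℕ} [NeZero c] {t : ℕ} {a : ℤ} (hc : (c : ℤ) = (t : ℤ) ^ 2 + ((t : ℤ) + 1) ^ 2)
    (ha : (c : ℤ) ∣ ((t : ℤ) + 1) * a - t) (ha' : (c : ℤ) ∣ (t : ℤ) * a + (t + 1)) :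
    (code (a : ZMod c) (1 : ZMod c)).flatFin.HasOptimalRadius t :=
  (rotated_isCode hc ha ha').flatFin_hasOptimalRadius (by omega)

/-- **KP13 Example 7, `⟦2n²c, 2, n(2t+1)⟧` for every `n ≥ 1`, `t`: optimal Pauli-level radius `⌊(n(2t+1) − 1)/2⌋`, attained.**
[cite: KovalevPryadko2013Hyperbicycle, §IV Ex. 7 (p0016 L18-24)] [cite: Gottesman1997, §2.3 (chunk p0014 L3)] -/
theorem dilated_flatFin_hasOptimalRadius {n N : ℕ} [NeZero n] [NeZero N] {c t : ℕ} {a : ℤ} (hN : N = n * c)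
    (hc : (c : ℤ) = (t : ℤ) ^ 2 + ((t : ℤ) + 1) ^ 2) (ha : (c : ℤ) ∣ ((t : ℤ) + 1) * a - t)
    (ha' : (c : ℤ) ∣ (t : ℤ) * a + (t + 1)) :
    (code ((1 : ZMod n), (a : ZMod N)) ((0 : ZMod n), (1 : ZMod N))).flatFin.HasOptimalRadius ((n * (2 * t + 1) - 1) / 2) :=
  (dilated_isCode hN hc ha ha').flatFin_hasOptimalRadius rfl

end TwistedToric

end Literature.InformationTheory.QuantumCodes
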